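import Mathlib
import Summits.CriticalPhenomena.Ising3DConformalLimit.Theses.PlantedPinning
import Summits.CriticalPhenomena.Ising3DConformalLimit.Theorems.PlantedPinningPinningLemmaCeilingTower
import HarnessLib

/-!
# The pinning-lemma ceiling: item `PinningLemmaCeiling` (stmt-CriticalPhenomena-8454)
# of route `PlantedPinning`

For every `n`, every probability weight `w` on `{±1}^n` (coded `Fin n → Bool`), the total spin
`M = ∑ᵢ σᵢ` and every `1 ≤ k ≤ n`, the planted conditional variance of `M` averaged over uniform
`k`-subsets `P` and `w`-distributed patterns `τ` satisfies

  `k · (C(n,k))⁻¹ · ∑_{|P| = k} ∑_τ w(τ) · Var_w(M | σ_P = τ_P) ≤ (n + 1) · (n − k + 1)`.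

This is the "pinning lemma" ceiling (Montanari 2008; Raghavendra–Tan 2012) with its constant.

Proof (finite sums only).  With `V(P) = ∑_τ w τ · Var_w(M | σ_P = τ_P)` the companion file
`PlantedPinningPinningLemmaCeilingTower` proves the one-pin step
`∑_{z ∉ P} V(P ∪ z) ≤ (n − j) V(P) − V(P)²/(n − j)` (`|P| = j`).  Here: double counting over
`j`-subsets (`sum_powersetCard_insert`) and Cauchy–Schwarz over `P` give, for the totals
`Φ_j = ∑_{|P| = j} V(P)` and `C = C(n,j)`, `c = n − j`, the cleared-denominator Riccati step
`C c (j+1) Φ_{j+1} ≤ C c² Φ_j − Φ_j²` (`Phi_step`); the scalar lemma `scalar_core`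
(`(j+1) a (c² − a) ≤ m c³` whenever `0 ≤ a`, `j a ≤ m (c+1)`, `m = c + j + 1`) drives the induction
`j Φ_j ≤ (n+1)(n−j+1) C(n,j)` (`main_induction`), i.e. `1/a_{j+1} ≥ 1/a_j + 1/(n−j)²` integrated to
`a_k ≤ (n+1)(n−k+1)/k` for the averages `a_j = Φ_j / C(n,j)`.

* `sum_powersetCard_insert` — double counting `(P, z ∉ P) ↔ (Q, z ∈ Q)`;
* `scalar_core`, `Phi_step`, `main_induction`, `ceiling` — the Riccati induction;
* `pinningLemmaCeiling_proof` — the item, verbatim (instantiating the companion file's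
  variables `Z, cE, s, M, V` with the item's `let`-bound terms).

Theorem-only file.  References: A. Montanari, arXiv:0709.0145, §3;
P. Raghavendra, N. Tan, SODA 2012, doi:10.1137/1.9781611973099.33, Lemma 4.1 (pinning lemma);
A. El Alaoui, A. Montanari, arXiv:2109.00709, eqs. (1.4)–(1.6).
-/

noncomputable section

open Finset

namespace Summit.CriticalPhenomena.Ising3DConformalLimit.Theorems

namespace PinningLemma

/-- Double counting: summing `F(P ∪ z)` over `j`-subsets `P ⊆ S` and `z ∈ S ∖ P` counts every
`(j+1)`-subset `j + 1` times. -/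
theorem sum_powersetCard_insert {α : Type*} [DecidableEq α] (S : Finset α) (j : ℕ)
    (F : Finset α → ℝ) :
    ∑ P ∈ S.powersetCard j, ∑ z ∈ S \ P, F (insert z P)
      = ((j : ℝ) + 1) * ∑ Q ∈ S.powersetCard (j + 1), F Q := by
  calc ∑ P ∈ S.powersetCard j, ∑ z ∈ S \ P, F (insert z P)
      = ∑ Q ∈ S.powersetCard (j + 1), ∑ _z ∈ Q, F Q := by
        rw [sum_sigma', sum_sigma']
        refine sum_bij' (fun p _ => ⟨insert p.2 p.1, p.2⟩) (fun q _ => ⟨q.1.erase q.2, q.2⟩)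
          ?_ ?_ ?_ ?_ ?_
        · rintro ⟨P, z⟩ hp
          simp only [mem_sigma, mem_powersetCard, mem_sdiff] at hp ⊢
          obtain ⟨⟨hPs, hcard⟩, hzs, hzP⟩ := hp
          exact ⟨⟨insert_subset hzs hPs, by rw [card_insert_of_notMem hzP, hcard]⟩,
            mem_insert_self z P⟩
        · rintro ⟨Q, z⟩ hq
          simp only [mem_sigma, mem_powersetCard, mem_sdiff] at hq ⊢
          obtain ⟨⟨hQs, hcard⟩, hzQ⟩ := hq
          exact ⟨⟨(erase_subset z Q).trans hQs, by rw [card_erase_of_mem hzQ, hcard]; rfl⟩,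
            hQs hzQ, notMem_erase z Q⟩
        · rintro ⟨P, z⟩ hp
          simp only [mem_sigma, mem_powersetCard, mem_sdiff] at hp
          simp only [erase_insert hp.2.2]
        · rintro ⟨Q, z⟩ hq
          simp only [mem_sigma, mem_powersetCard] at hq
          simp only [insert_erase hq.2]
        · rintro ⟨P, z⟩ _
          rfl
    _ = ((j : ℝ) + 1) * ∑ Q ∈ S.powersetCard (j + 1), F Q := by
        rw [mul_sum]
        refine sum_congr rfl (fun Q hQ => ?_)
        rw [sum_const, nsmul_eq_mul, (mem_powersetCard.1 hQ).2]
        push_cast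
        ring

/-- The scalar heart of the Riccati step: for `a ≥ 0`, `c ≥ 1`, `j ≥ 0`, `m = c + j + 1` and
`j · a ≤ m (c + 1)` one has `(j + 1) · a · (c² − a) ≤ m · c³`. -/
theorem scalar_core {a c j m : ℝ} (ha : 0 ≤ a) (hc : 1 ≤ c) (hj : 0 ≤ j) (hm : m = c + j + 1)
    (hb : j * a ≤ m * (c + 1)) : (j + 1) * a * (c ^ 2 - a) ≤ m * c ^ 3 := by
  have hc0 : 0 < c := by linarith
  have key : (j + 1) * a * c ≤ m * (a + c ^ 2) := by
    rcases le_or_gt (j * c - j - 1) 0 with h | h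
    · have h1 : 0 ≤ a * (-(j * c - j - 1)) := mul_nonneg ha (by linarith)
      have h2 : 0 ≤ m * c ^ 2 := by rw [hm]; positivity
      nlinarith [h1, h2]
    · have hj0 : 0 < j := by
        by_contra hj0
        have : j = 0 := le_antisymm (not_lt.1 hj0) hj
        rw [this] at h; linarith
      have iden : j * (m * (a + c ^ 2) - (j + 1) * a * c)
          = m ^ 2 + (m * (c + 1) - j * a) * (j * c - j - 1) := by
        rw [hm]; ring
      have hnn : 0 ≤ m ^ 2 + (m * (c + 1) - j * a) * (j * c - j - 1) :=
        add_nonneg (sq_nonneg m) (mul_nonneg (sub_nonneg.2 hb) h.le)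
      have h3 : j * 0 ≤ j * (m * (a + c ^ 2) - (j + 1) * a * c) := by
        rw [mul_zero, iden]; exact hnn
      have h4 := le_of_mul_le_mul_left h3 hj0
      linarith
  have hpos : 0 < a + c ^ 2 := by positivity
  have h1 : (j + 1) * a * (c ^ 2 - a) * (a + c ^ 2) ≤ m * c ^ 3 * (a + c ^ 2) := by
    calc (j + 1) * a * (c ^ 2 - a) * (a + c ^ 2)
        = (j + 1) * a * c * c ^ 3 - (j + 1) * a ^ 3 := by ring
      _ ≤ (j + 1) * a * c * c ^ 3 := by nlinarith [pow_nonneg ha 3]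
      _ ≤ m * (a + c ^ 2) * c ^ 3 := mul_le_mul_of_nonneg_right key (by positivity)
      _ = m * c ^ 3 * (a + c ^ 2) := by ring
  exact le_of_mul_le_mul_right h1 hpos

variable {n : ℕ} {w : (Fin n → Bool) → ℝ}
  {Z : Finset (Fin n) → (Fin n → Bool) → ℝ}
  {cE : Finset (Fin n) → ((Fin n → Bool) → ℝ) → (Fin n → Bool) → ℝ}
  {s : Fin n → (Fin n → Bool) → ℝ} {M : (Fin n → Bool) → ℝ} {V : Finset (Fin n) → ℝ}
  {Φ : ℕ → ℝ}

/-- The Riccati step for the totals, denominators cleared: with `C = C(n,j)`, `c = n − j`,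
`C c (j+1) Φ_{j+1} ≤ C c² Φ_j − Φ_j²`. -/
theorem Phi_step (hw : ∀ σ, 0 ≤ w σ) (hsum : ∑ σ, w σ = 1)
    (hZ : ∀ P τ, Z P τ = ∑ σ ∈ univ.filter (fun ρ => ∀ i ∈ P, ρ i = τ i), w σ)
    (hcE : ∀ P f τ, cE P f τ
      = (∑ σ ∈ univ.filter (fun ρ => ∀ i ∈ P, ρ i = τ i), w σ * f σ) / Z P τ)
    (hs : ∀ (z : Fin n) (σ τ : Fin n → Bool), σ z = τ z → s z σ = s z τ)
    (hs2 : ∀ (z : Fin n) (σ : Fin n → Bool), s z σ ^ 2 = 1)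
    (hM : ∀ σ, M σ = ∑ z, s z σ)
    (hV : ∀ P, V P = ∑ τ, w τ * (cE P (fun σ => M σ ^ 2) τ - cE P M τ ^ 2))
    (hΦ : ∀ j, Φ j = ∑ P ∈ (univ : Finset (Fin n)).powersetCard j, V P)
    {j : ℕ} (hj : j < n) :
    (n.choose j : ℝ) * ((n : ℝ) - j) * (((j : ℝ) + 1) * Φ (j + 1))
      ≤ (n.choose j : ℝ) * ((n : ℝ) - j) ^ 2 * Φ j - Φ j ^ 2 := by
  have hc : (0 : ℝ) < (n : ℝ) - j := by
    have : (j : ℝ) < n := by exact_mod_cast hj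
    linarith
  have hC : (0 : ℝ) < (n.choose j : ℝ) := by exact_mod_cast Nat.choose_pos hj.le
  have hcard : ∀ P ∈ (univ : Finset (Fin n)).powersetCard j, ((Pᶜ.card : ℕ) : ℝ) = (n : ℝ) - j := by
    intro P hP
    rw [Finset.card_compl, Fintype.card_fin, (mem_powersetCard.1 hP).2, Nat.cast_sub hj.le]
  have h1 : ((j : ℝ) + 1) * Φ (j + 1)
      = ∑ P ∈ (univ : Finset (Fin n)).powersetCard j, ∑ z ∈ Pᶜ, V (insert z P) := by
    rw [hΦ, ← sum_powersetCard_insert]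
    simp only [compl_eq_univ_sdiff]
  have h2 : ∑ P ∈ (univ : Finset (Fin n)).powersetCard j, ∑ z ∈ Pᶜ, V (insert z P)
      ≤ ∑ P ∈ (univ : Finset (Fin n)).powersetCard j,
          (((n : ℝ) - j) * V P - V P ^ 2 / ((n : ℝ) - j)) := by
    refine sum_le_sum (fun P hP => ?_)
    have h := one_step hw hsum hZ hcE hs hs2 hM hV P (by rw [hcard P hP]; exact hc)
    rwa [hcard P hP] at h
  have h3 : Φ j ^ 2 ≤ (n.choose j : ℝ) * ∑ P ∈ (univ : Finset (Fin n)).powersetCard j, V P ^ 2 := by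
    have h := sum_mul_sq_le_sq_mul_sq ((univ : Finset (Fin n)).powersetCard j)
      (fun _ => (1 : ℝ)) V
    simpa [hΦ, card_powersetCard] using h
  have h4 : ((j : ℝ) + 1) * Φ (j + 1)
      ≤ ((n : ℝ) - j) * Φ j
        - (∑ P ∈ (univ : Finset (Fin n)).powersetCard j, V P ^ 2) / ((n : ℝ) - j) := by
    rw [h1]
    refine h2.trans (le_of_eq ?_)
    rw [sum_sub_distrib, ← mul_sum, ← sum_div, ← hΦ]
  have h5 := mul_le_mul_of_nonneg_left h4 (le_of_lt (mul_pos hC hc))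
  calc _ ≤ (n.choose j : ℝ) * ((n : ℝ) - j) * (((n : ℝ) - j) * Φ j
        - (∑ P ∈ (univ : Finset (Fin n)).powersetCard j, V P ^ 2) / ((n : ℝ) - j)) := h5
    _ = (n.choose j : ℝ) * ((n : ℝ) - j) ^ 2 * Φ j
        - (n.choose j : ℝ) * ∑ P ∈ (univ : Finset (Fin n)).powersetCard j, V P ^ 2 := by
        field_simp
    _ ≤ _ := by linarith [h3]

/-- **The Riccati induction**: `j · Φ_j ≤ (n + 1)(n − j + 1) · C(n, j)` for `j ≤ n`. -/
theorem main_induction (hw : ∀ σ, 0 ≤ w σ) (hsum : ∑ σ, w σ = 1)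
    (hZ : ∀ P τ, Z P τ = ∑ σ ∈ univ.filter (fun ρ => ∀ i ∈ P, ρ i = τ i), w σ)
    (hcE : ∀ P f τ, cE P f τ
      = (∑ σ ∈ univ.filter (fun ρ => ∀ i ∈ P, ρ i = τ i), w σ * f σ) / Z P τ)
    (hs : ∀ (z : Fin n) (σ τ : Fin n → Bool), σ z = τ z → s z σ = s z τ)
    (hs2 : ∀ (z : Fin n) (σ : Fin n → Bool), s z σ ^ 2 = 1)
    (hM : ∀ σ, M σ = ∑ z, s z σ)
    (hV : ∀ P, V P = ∑ τ, w τ * (cE P (fun σ => M σ ^ 2) τ - cE P M τ ^ 2))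
    (hΦ : ∀ j, Φ j = ∑ P ∈ (univ : Finset (Fin n)).powersetCard j, V P)
    (j : ℕ) (hj : j ≤ n) :
    (j : ℝ) * Φ j ≤ ((n : ℝ) + 1) * ((n : ℝ) - j + 1) * (n.choose j : ℝ) := by
  induction j with
  | zero =>
      simp only [Nat.cast_zero, zero_mul, sub_zero, Nat.choose_zero_right, Nat.cast_one, mul_one]
      positivity
  | succ j ihj =>
      have hjn : j < n := hj
      have ih := ihj hjn.le
      have step := Phi_step hw hsum hZ hcE hs hs2 hM hV hΦ hjn
      have hC : (0 : ℝ) < (n.choose j : ℝ) := by exact_mod_cast Nat.choose_pos hjn.le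
      have hc1 : (1 : ℝ) ≤ (n : ℝ) - j := by
        have h : ((j + 1 : ℕ) : ℝ) ≤ n := by exact_mod_cast hj
        push_cast at h
        linarith
      have hc0 : (0 : ℝ) < (n : ℝ) - j := by linarith
      have hchoose : ((j : ℝ) + 1) * (n.choose (j + 1) : ℝ) = ((n : ℝ) - j) * (n.choose j : ℝ) := by
        have h := Nat.choose_succ_right_eq n j
        have h' : ((n.choose (j + 1) : ℕ) : ℝ) * ((j : ℝ) + 1)
            = (n.choose j : ℝ) * ((n : ℝ) - j) := by
          rw [← Nat.cast_sub hjn.le]; exact_mod_cast h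
        linarith
      have hΦnn : 0 ≤ Φ j := by
        rw [hΦ]; exact sum_nonneg (fun P _ => V_nonneg hw hZ hcE hV P)
      -- the average `x = Φ_j / C(n,j)`
      set A := Φ j with hA
      set A' := Φ (j + 1) with hA'
      set C : ℝ := (n.choose j : ℝ) with hCdef
      set C' : ℝ := (n.choose (j + 1) : ℝ) with hC'def
      set c : ℝ := (n : ℝ) - j with hcdef
      set x : ℝ := A / C with hxdef
      have hAx : A = C * x := by rw [hxdef]; field_simp
      have hx : 0 ≤ x := div_nonneg hΦnn hC.le
      have ihx : (j : ℝ) * x ≤ (c + j + 1) * (c + 1) := by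
        have h1 : C * ((j : ℝ) * x) ≤ C * ((c + j + 1) * (c + 1)) := by
          calc C * ((j : ℝ) * x) = (j : ℝ) * A := by rw [hAx]; ring
            _ ≤ ((n : ℝ) + 1) * (c + 1) * C := ih
            _ = C * ((c + j + 1) * (c + 1)) := by rw [hcdef]; ring
        exact le_of_mul_le_mul_left h1 hC
      have core := scalar_core hx hc1 (Nat.cast_nonneg j) rfl ihx
      have f1 : C * c * (((j : ℝ) + 1) * (((j : ℝ) + 1) * A'))
          ≤ C * (C * (((j : ℝ) + 1) * x * (c ^ 2 - x))) := by
        have h := mul_le_mul_of_nonneg_left step (by positivity : (0 : ℝ) ≤ (j : ℝ) + 1)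
        calc C * c * (((j : ℝ) + 1) * (((j : ℝ) + 1) * A'))
            = ((j : ℝ) + 1) * (C * c * (((j : ℝ) + 1) * A')) := by ring
          _ ≤ ((j : ℝ) + 1) * (C * c ^ 2 * A - A ^ 2) := h
          _ = C * (C * (((j : ℝ) + 1) * x * (c ^ 2 - x))) := by rw [hAx]; ring
      have f2 : C * (C * (((j : ℝ) + 1) * x * (c ^ 2 - x))) ≤ C * (C * ((c + j + 1) * c ^ 3)) :=
        mul_le_mul_of_nonneg_left (mul_le_mul_of_nonneg_left core hC.le) hC.le
      have f3 : ((j : ℝ) + 1) * (((j : ℝ) + 1) * A') ≤ C * ((c + j + 1) * c ^ 2) := by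
        have h := f1.trans f2
        have h' : C * c * (((j : ℝ) + 1) * (((j : ℝ) + 1) * A'))
            ≤ C * c * (C * ((c + j + 1) * c ^ 2)) := by
          calc _ ≤ _ := h
            _ = _ := by ring
        exact le_of_mul_le_mul_left h' (mul_pos hC hc0)
      have f4 : ((j : ℝ) + 1) * (((j : ℝ) + 1) * A') ≤ ((j : ℝ) + 1) * ((c + j + 1) * c * C') := by
        calc _ ≤ C * ((c + j + 1) * c ^ 2) := f3
          _ = (c * C) * ((c + j + 1) * c) := by ring
          _ = ((j : ℝ) + 1) * C' * ((c + j + 1) * c) := by rw [hchoose]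
          _ = _ := by ring
      have f5 := le_of_mul_le_mul_left f4 (by positivity : (0 : ℝ) < (j : ℝ) + 1)
      calc (((j + 1 : ℕ)) : ℝ) * A' = ((j : ℝ) + 1) * A' := by push_cast; ring
        _ ≤ (c + j + 1) * c * C' := f5
        _ = ((n : ℝ) + 1) * ((n : ℝ) - ((j + 1 : ℕ) : ℝ) + 1) * C' := by
            rw [hcdef]; push_cast; ring

/-- **The ceiling**, for abstract `Z, cE, s, M, V` characterised by their defining formulae. -/
theorem ceiling (hw : ∀ σ, 0 ≤ w σ) (hsum : ∑ σ, w σ = 1)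
    (hZ : ∀ P τ, Z P τ = ∑ σ ∈ univ.filter (fun ρ => ∀ i ∈ P, ρ i = τ i), w σ)
    (hcE : ∀ P f τ, cE P f τ
      = (∑ σ ∈ univ.filter (fun ρ => ∀ i ∈ P, ρ i = τ i), w σ * f σ) / Z P τ)
    (hs : ∀ (z : Fin n) (σ τ : Fin n → Bool), σ z = τ z → s z σ = s z τ)
    (hs2 : ∀ (z : Fin n) (σ : Fin n → Bool), s z σ ^ 2 = 1)
    (hM : ∀ σ, M σ = ∑ z, s z σ)
    (hV : ∀ P, V P = ∑ τ, w τ * (cE P (fun σ => M σ ^ 2) τ - cE P M τ ^ 2))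
    {k : ℕ} (hkn : k ≤ n) :
    (k : ℝ) * (∑ P ∈ (univ : Finset (Fin n)).powersetCard k, V P) / (n.choose k : ℝ)
      ≤ ((n : ℝ) + 1) * ((n : ℝ) - k + 1) := by
  have h := main_induction hw hsum hZ hcE hs hs2 hM hV
    (Φ := fun j => ∑ P ∈ (univ : Finset (Fin n)).powersetCard j, V P) (fun _ => rfl) k hkn
  have hC : (0 : ℝ) < (n.choose k : ℝ) := by exact_mod_cast Nat.choose_pos hkn
  rw [div_le_iff₀ hC]
  exact h

end PinningLemma

open PinningLemma in
/-- **The pinning-lemma ceiling** (item `PinningLemmaCeiling`, stmt-CriticalPhenomena-8454):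
for every `n`, every probability weight `w` on `Fin n → Bool`, `M = ∑ᵢ σᵢ` and `1 ≤ k ≤ n`,
`k · (C(n,k))⁻¹ ∑_{|P| = k} ∑_τ w τ · Var_w(M | σ_P = τ_P) ≤ (n + 1)(n − k + 1)`
(Montanari 2008; Raghavendra–Tan 2012, pinning lemma). -/
theorem pinningLemmaCeiling_proof :
    Summit.CriticalPhenomena.Ising3DConformalLimit.Theses.PlantedPinning.PinningLemmaCeiling := by
  intro n k w _hk hkn hw hsum M Z E1 E2
  exact ceiling (Z := Z)
    (cE := fun P f τ => (∑ σ, if (∀ i ∈ P, σ i = τ i) then w σ * f σ else 0) / Z P τ)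
    (s := fun z σ => if σ z then (1 : ℝ) else -1) (M := M)
    (V := fun P => ∑ τ, w τ * (E2 P τ - E1 P τ ^ 2))
    hw hsum (fun P τ => (sum_filter _ _).symm)
    (fun P f τ => by
      show (∑ σ, if (∀ i ∈ P, σ i = τ i) then w σ * f σ else 0) / Z P τ = _
      rw [sum_filter])
    (fun z σ τ h => by
      show (if σ z then (1 : ℝ) else -1) = (if τ z then (1 : ℝ) else -1)
      rw [h])
    (fun z σ => by
      show (if σ z then (1 : ℝ) else -1) ^ 2 = 1
      split_ifs <;> norm_num)
    (fun σ => rfl) (fun P => rfl) hkn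

end Summit.CriticalPhenomena.Ising3DConformalLimit.Theorems

end
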